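import Summits.CriticalPhenomena.PercolationContinuityZ3.Theorems.PercNearOneGluingNoHeavyLowerTailKNGoodGMgcWorldMix
import Literature.Probability.Percolation.KozmaNitzanGoodQuadruple
import Summits.CriticalPhenomena.PercolationContinuityZ3.Theorems.PercNearOneGluingNoHeavyLowerTailKernelTools
import HarnessLib

/-!
# Almost-sure cell tools: loops are invisible, cut sets, sure joins, "this set is the cluster"
# (`NoHeavyLowerTail` cell, stmt-CriticalPhenomena-4575; prover `prim-hp-2`, gen 19 — tools for brick L5 of the semantic layer of THEOREM B,
# memo `run/shared/lean/prim/prim-hp-2/MEMO-gen17-lean-certificates.md` §4')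

Support file (`--supports stmt-CriticalPhenomena-4575`; imports the COMPUTATIONAL `…KNGoodGMgcSideGlue` through `…WorldMix`).
No definitions, no named facts, no sorries.  Generic facts about `prodBernoulli` on the pairs of `Fin n`:
* `real_openConn_congr_offDiag` — weights that agree off the diagonal give the same reliabilities (loops are invisible);
* `real_openConnIn_eq_restrW` — `μ_w(a ↔ b in S) = μ_{restrW S w}(a ↔ b)` for `a ∈ S`;
* `real_eq_of_compl_null`, `real_compl_openConn_eq_zero_trans` (with `UpsetExchange.real_not_openConn_eq_zero_of_surePair`: a weight-one pair is a.s. open),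
  `real_openConn_eq_of_joined`, `real_clusterIs_eq_zero_of_joined` (a.s. joins and their consequences);
* `real_exists_leave_eq_zero`, `real_openConn_eq_zero_of_cut` (a set whose boundary pairs have weight `0` is a.s. closed);
* **`real_clusterIs_eq_one`** — `x ∈ U`, boundary of `U` of weight `0`, every vertex of `U` a.s. joined to `x` ⇒ `μ(C(x) = U) = 1`;
  `real_clusterIs_eq_zero_of_ne`.
Used by `…KNGoodGMgcSideCells.lean` (the deterministic sides of THEOREM B's contracted observer).
-/

noncomputable section

namespace Summit.CriticalPhenomena.PercolationContinuityZ3.Theorems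

namespace KNGoodGMgc

open MeasureTheory Set Literature.Probability.LatticeModels Literature.Probability.Percolation KNGoodAux
open scoped Classical

variable {n : ℕ}

/-! ## Generic almost-sure tools -/

/-- Reliabilities do not see loop weights: weights that agree off the diagonal give the same `μ(a ↔ b)`. [folklore] -/
theorem real_openConn_congr_offDiag (w w' : Sym2 (Fin n) → unitInterval) (h : ∀ f : Sym2 (Fin n), ¬f.IsDiag → w f = w' f)
    (a b : Fin n) : (prodBernoulli w).real (openConn a b) = (prodBernoulli w').real (openConn a b) := by
  rw [← KozmaNitzan.openConnIn_univ_eq' a b]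
  exact prodBernoulli_real_eq_of_determinedBy w w' (F := wireSet (univ : Set (Fin n))) (fun f hf => h f hf.2)
    (KozmaNitzan.determinedBy_openConnIn_wireSet univ a b subset_rfl) MeasurableSet.of_discrete

/-- `μ_w(a ↔ b in S) = μ_{restrW S w}(a ↔ b)` for `a ∈ S`. [folklore] -/
theorem real_openConnIn_eq_restrW (w : Sym2 (Fin n) → unitInterval) (S : Set (Fin n)) (a b : Fin n) (ha : a ∈ S) :
    (prodBernoulli w).real (openConnIn S a b) = (prodBernoulli (restrW S w)).real (openConn a b) := by
  rw [restrW_real_eq]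
  congr 1
  ext ω
  exact (inter_wireSet_mem_openConn_iff ha b).symm

/-- Two events that agree off a null set have the same probability. [folklore] -/
theorem real_eq_of_compl_null (w : Sym2 (Fin n) → unitInterval) (A B N : Set (BondConfig (Fin n)))
    (hN : (prodBernoulli w).real N = 0) (h : ∀ ω, ω ∉ N → (ω ∈ A ↔ ω ∈ B)) :
    (prodBernoulli w).real A = (prodBernoulli w).real B := by
  haveI : IsProbabilityMeasure (prodBernoulli w) := inferInstance
  refine real_eq_of_inter_compl_eq (prodBernoulli w) A B N hN ?_
  ext ω
  simp only [mem_inter_iff, mem_compl_iff]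
  constructor
  · rintro ⟨hA, hn⟩; exact ⟨(h ω hn).1 hA, hn⟩
  · rintro ⟨hB, hn⟩; exact ⟨(h ω hn).2 hB, hn⟩

/-- Almost-sure joins compose. [folklore] -/
theorem real_compl_openConn_eq_zero_trans (w : Sym2 (Fin n) → unitInterval) (p q r : Fin n)
    (h1 : (prodBernoulli w).real (openConn p q)ᶜ = 0) (h2 : (prodBernoulli w).real (openConn q r)ᶜ = 0) :
    (prodBernoulli w).real (openConn p r)ᶜ = 0 := by
  have hsub : ((openConn p r)ᶜ : Set (BondConfig (Fin n))) ⊆ (openConn p q)ᶜ ∪ (openConn q r)ᶜ := by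
    intro ω hω
    by_contra h
    simp only [mem_union, mem_compl_iff, not_or, not_not] at h
    exact hω ((h.1 : (openGraph ω).Reachable p q).trans h.2)
  apply le_antisymm _ measureReal_nonneg
  calc (prodBernoulli w).real (openConn p r)ᶜ
      ≤ (prodBernoulli w).real ((openConn p q)ᶜ ∪ (openConn q r)ᶜ) := measureReal_mono hsub (measure_ne_top _ _)
    _ ≤ (prodBernoulli w).real (openConn p q)ᶜ + (prodBernoulli w).real (openConn q r)ᶜ := measureReal_union_le _ _
    _ = 0 := by rw [h1, h2, add_zero]

/-- If `x` is almost surely joined to `a`, then `μ(x ↔ t) = μ(a ↔ t)`. [folklore] -/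
theorem real_openConn_eq_of_joined (w : Sym2 (Fin n) → unitInterval) (x a t : Fin n)
    (h : (prodBernoulli w).real (openConn x a)ᶜ = 0) :
    (prodBernoulli w).real (openConn x t) = (prodBernoulli w).real (openConn a t) := by
  refine real_eq_of_compl_null w _ _ _ h fun ω hω => ?_
  simp only [mem_compl_iff, not_not] at hω
  have hxa : (openGraph ω).Reachable x a := hω
  exact ⟨fun hxt => hxa.symm.trans hxt, fun hat => hxa.trans hat⟩

/-- If `x` is almost surely joined to some `a ∉ W`, then `μ(C(x) = W) = 0`. [folklore] -/
theorem real_clusterIs_eq_zero_of_joined (w : Sym2 (Fin n) → unitInterval) (x a : Fin n) (W : Finset (Fin n)) (haW : a ∉ W)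
    (h : (prodBernoulli w).real (openConn x a)ᶜ = 0) : (prodBernoulli w).real (clusterIs x W) = 0 := by
  have hsub : (clusterIs x W : Set (BondConfig (Fin n))) ⊆ (openConn x a)ᶜ := by
    intro ω hω hxa
    apply haW
    rw [mem_clusterIs] at hω
    have : a ∈ openCluster ω x := hxa
    rw [hω] at this
    exact Finset.mem_coe.1 this
  exact le_antisymm ((measureReal_mono hsub (measure_ne_top _ _)).trans h.le) measureReal_nonneg

/-- Under weights vanishing on the boundary of `U`, almost surely no open pair leaves `U`. [folklore] -/
theorem real_exists_leave_eq_zero (w : Sym2 (Fin n) → unitInterval) (U : Finset (Fin n))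
    (hcut : ∀ p ∈ U, ∀ t : Fin n, t ∉ U → w s(p, t) = 0) :
    (prodBernoulli w).real {ω : BondConfig (Fin n) | ∃ p ∈ U, ∃ t : Fin n, t ∉ U ∧ s(p, t) ∈ ω} = 0 := by
  set F : Finset (Sym2 (Fin n)) := Finset.univ.filter (fun e => ∃ p ∈ U, ∃ t : Fin n, t ∉ U ∧ e = s(p, t)) with hF
  have hsub : {ω : BondConfig (Fin n) | ∃ p ∈ U, ∃ t : Fin n, t ∉ U ∧ s(p, t) ∈ ω} ⊆ {ω | ∃ e ∈ F, e ∈ ω} := by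
    rintro ω ⟨p, hp, t, ht, he⟩
    exact ⟨s(p, t), Finset.mem_filter.2 ⟨Finset.mem_univ _, p, hp, t, ht, rfl⟩, he⟩
  apply le_antisymm _ measureReal_nonneg
  calc (prodBernoulli w).real {ω : BondConfig (Fin n) | ∃ p ∈ U, ∃ t : Fin n, t ∉ U ∧ s(p, t) ∈ ω}
      ≤ (prodBernoulli w).real {ω | ∃ e ∈ F, e ∈ ω} := measureReal_mono hsub (measure_ne_top _ _)
    _ ≤ ∑ e ∈ F, (w e : ℝ) := prodBernoulli_real_exists_mem_le_sum w F
    _ = 0 := Finset.sum_eq_zero fun e he => by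
        obtain ⟨-, p, hp, t, ht, rfl⟩ := Finset.mem_filter.1 he
        rw [hcut p hp t ht]; rfl

/-- A vertex in a set `U` with weight-`0` boundary is joined to nothing outside `U`. [folklore] -/
theorem real_openConn_eq_zero_of_cut (w : Sym2 (Fin n) → unitInterval) (U : Finset (Fin n)) (x t : Fin n) (hx : x ∈ U)
    (ht : t ∉ U) (hcut : ∀ p ∈ U, ∀ t : Fin n, t ∉ U → w s(p, t) = 0) : (prodBernoulli w).real (openConn x t) = 0 := by
  have hN := real_exists_leave_eq_zero w U hcut
  rw [← measureReal_empty (μ := prodBernoulli w)]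
  refine real_eq_of_compl_null w _ _ _ hN fun ω hω => ?_
  simp only [mem_empty_iff_false, iff_false]
  intro hxt
  obtain ⟨p⟩ := (hxt : (openGraph ω).Reachable x t)
  have hcl : ∀ a ∈ (↑U : Set (Fin n)), ∀ b, s(a, b) ∈ ω → a ≠ b → b ∈ (↑U : Set (Fin n)) := by
    intro a ha b hab _
    by_contra hb
    exact hω ⟨a, Finset.mem_coe.1 ha, b, fun h => hb (Finset.mem_coe.2 h), hab⟩
  exact ht (Finset.mem_coe.1 (walk_end_mem_of_closed hcl p (Finset.mem_coe.2 hx) t p.end_mem_support))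

/-- **A set with sure internal joins and weight-`0` boundary is almost surely the cluster.**  If `x ∈ U`, every pair leaving `U`
has weight `0`, and every vertex of `U` is almost surely joined to `x`, then `μ(C(x) = U) = 1`. [folklore] -/
theorem real_clusterIs_eq_one (w : Sym2 (Fin n) → unitInterval) (U : Finset (Fin n)) (x : Fin n) (hx : x ∈ U)
    (hcut : ∀ p ∈ U, ∀ t : Fin n, t ∉ U → w s(p, t) = 0)
    (hjoin : ∀ v ∈ U, (prodBernoulli w).real (openConn x v)ᶜ = 0) :
    (prodBernoulli w).real (clusterIs x U) = 1 := by
  haveI : IsProbabilityMeasure (prodBernoulli w) := inferInstance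
  set N : Set (BondConfig (Fin n)) := {ω | ∃ p ∈ U, ∃ t : Fin n, t ∉ U ∧ s(p, t) ∈ ω} with hNdef
  have hN := real_exists_leave_eq_zero w U hcut
  have hsub : (clusterIs x U)ᶜ ⊆ N ∪ ⋃ v ∈ U, (openConn x v)ᶜ := by
    intro ω hω
    by_contra hcon
    simp only [mem_union, mem_iUnion, mem_compl_iff, exists_prop, not_or, not_exists, not_and, not_not] at hcon
    obtain ⟨hωN, hωj⟩ := hcon
    apply hω
    rw [mem_clusterIs]
    ext y
    constructor
    · intro hy
      obtain ⟨p⟩ := (hy : (openGraph ω).Reachable x y)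
      have hcl : ∀ a ∈ (↑U : Set (Fin n)), ∀ b, s(a, b) ∈ ω → a ≠ b → b ∈ (↑U : Set (Fin n)) := by
        intro a ha b hab _
        by_contra hb
        exact hωN ⟨a, Finset.mem_coe.1 ha, b, fun h => hb (Finset.mem_coe.2 h), hab⟩
      exact walk_end_mem_of_closed hcl p (Finset.mem_coe.2 hx) y p.end_mem_support
    · intro hy
      exact hωj y (Finset.mem_coe.1 hy)
  have hzero : (prodBernoulli w).real (clusterIs x U)ᶜ = 0 := by
    apply le_antisymm _ measureReal_nonneg
    calc (prodBernoulli w).real (clusterIs x U)ᶜ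
        ≤ (prodBernoulli w).real (N ∪ ⋃ v ∈ U, (openConn x v)ᶜ) := measureReal_mono hsub (measure_ne_top _ _)
      _ ≤ (prodBernoulli w).real N + (prodBernoulli w).real (⋃ v ∈ U, (openConn x v)ᶜ) := measureReal_union_le _ _
      _ ≤ (prodBernoulli w).real N + ∑ v ∈ U, (prodBernoulli w).real (openConn x v)ᶜ := by
          gcongr; exact measureReal_biUnion_finset_le U _
      _ = 0 := by rw [hN, Finset.sum_eq_zero fun v hv => hjoin v hv, add_zero]
  have := measureReal_compl (μ := prodBernoulli w) (s := clusterIs x U) MeasurableSet.of_discrete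
  rw [hzero, probReal_univ] at this
  linarith

/-- If `C(x) = U` almost surely then `μ(C(x) = W) = 0` for `W ≠ U`. [folklore] -/
theorem real_clusterIs_eq_zero_of_ne (w : Sym2 (Fin n) → unitInterval) (U W : Finset (Fin n)) (x : Fin n)
    (hU : (prodBernoulli w).real (clusterIs x U) = 1) (hW : W ≠ U) : (prodBernoulli w).real (clusterIs x W) = 0 := by
  haveI : IsProbabilityMeasure (prodBernoulli w) := inferInstance
  have hc : (prodBernoulli w).real (clusterIs x U)ᶜ = 0 := by
    have := measureReal_compl (μ := prodBernoulli w) (s := clusterIs x U) MeasurableSet.of_discrete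
    rw [hU, probReal_univ] at this
    linarith
  have hsub : (clusterIs x W : Set (BondConfig (Fin n))) ⊆ (clusterIs x U)ᶜ := by
    intro ω hω hωU
    apply hW
    rw [mem_clusterIs] at hω hωU
    exact Finset.coe_injective (hω.symm.trans hωU)
  exact le_antisymm ((measureReal_mono hsub (measure_ne_top _ _)).trans hc.le) measureReal_nonneg


end KNGoodGMgc

end Summit.CriticalPhenomena.PercolationContinuityZ3.Theorems

end
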